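import Summits.ABC.StewartYu.PadicG3ScheduleG
import HarnessLib

/-!
# Cell abc-stewartyu, crux `Y07Odd` (stmt-ABC-19658), line `gen3-slab-odd`: the record schedule as an ABSTRACT DATUM `G3Sched` (plan g8 rulings
# 2026-08-27T03:15Z / 03:39Z: two-branch record — `m = 0`: `PadicG3ParV`, `m ≥ 1`: v1 `PadicG3Par` —, ∃-assembly by cases = p2): the frame's
# instantiation is written ONCE over `G3Sched` and specialised to each parameter family by a 10-line instance (`PadicG3SchedInst`)

`Summits/ABC/StewartYu/PadicG3SchedS.lean` — cell `abc-stewartyu` (seat p2-g4, F-odd lead).  `structure G3Sched n` (slab depth `m`, box scale `Lbox`,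
heights `A`, `L₀`, `H ≥ 1`, depth `Sd`, ranges `Xs`, multiplicities `T`, orders `Mord` with the two DECREMENT LAWS
`Mord s (ν+1) + T s ≤ Mord s ν` (`ν < n`) and `Mord (s+1) 0 + T s ≤ Mord s n` (`s + 1 ≤ Sd`)), and over it the generic twins of
`PadicG3ScheduleG`: `sideS`, `NS`, `NhS`, `tS`, `remS`, `TordS`, `TordS_kstep`, `TordS_half`, `UcardS`, `card_unk_le_UcardS`.

References: Yu. V. Nesterenko, LNM 1819 (2003) (4.3)–(4.5).
-/

noncomputable section

open Finset
open Literature.NumberTheory.Transcendental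

namespace Summit.ABC.StewartYu

/-- **A record schedule** (the numbers the frame consumes, with the two decrement laws). [cite: Nesterenko2003, (4.3)–(4.5); shape only] -/
structure G3Sched (n : ℕ) where
  /-- slab depth -/
  m : ℕ
  /-- box scale: half-sides `⌊Lbox/(4Aⱼ)⌋` -/
  Lbox : ℝ
  /-- heights -/
  A : Fin n → ℝ
  /-- auxiliary degree -/
  L₀ : ℕ
  /-- Fel'dman parameter -/
  H : ℕ
  /-- depth (number of Kummer levels) -/
  Sd : ℕ
  /-- base ranges per level -/
  Xs : ℕ → ℕ
  /-- multiplicity decrement per level -/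
  T : ℕ → ℕ
  /-- orders of the states -/
  Mord : ℕ → ℕ → ℕ
  hA : ∀ j, 0 < A j
  hH : 1 ≤ H
  kstep_law : ∀ s ν, ν < n → Mord s (ν + 1) + T s ≤ Mord s ν
  half_law : ∀ s, s + 1 ≤ Sd → Mord (s + 1) 0 + T s ≤ Mord s n

namespace G3Setup

variable {p : ℕ} [Fact p.Prime] (S : G3Setup p) (D : G3Sched S.n)

/-- Box half-sides `⌊Lbox/(4Aⱼ)⌋`. [cite: Nesterenko2003, §3.4; shape only] -/
def sideS (j : Fin S.n) : ℕ := ⌊D.Lbox / (4 * D.A j)⌋₊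

/-- Symmetric node ranges `2^ν · Xs lev`. [cite: Nesterenko2003, (4.3)] -/
def NS (lev ν : ℕ) : ℕ := 2 ^ ν * D.Xs lev

/-- Odd node ranges: odd `|x| ≤ 2·Xs lev − 1`. [cite: Nesterenko2003, (4.3)] -/
def NhS (lev : ℕ) : ℕ := D.Xs lev

/-- Jets per node `T lev + 1`. [cite: Nesterenko2003, Lemma 4.3] -/
def tS (lev : ℕ) : ℕ := D.T lev + 1

/-- Transitions remaining after state `(lev, ν)`. [folklore] -/
def remS (lev ν : ℕ) : ℕ := (D.Sd - lev) * (S.n + 1) + (S.n - ν)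

/-- Orders of the state `(lev, ν)`: `Mord lev ν + remS lev ν`. [cite: Nesterenko2003, (4.5); shape only] -/
def TordS (lev ν : ℕ) : ℕ := D.Mord lev ν + S.remS D lev ν

/-- `1 ≤ tS`. [folklore] -/
theorem one_le_tS (lev : ℕ) : 1 ≤ S.tS D lev := by unfold tS; omega

/-- **Order condition of a k-step**: `TordS lev (ν+1) + tS lev ≤ TordS lev ν` for `ν < n`. [cite: Nesterenko2003, (4.5)] -/
theorem TordS_kstep (lev ν : ℕ) (hν : ν < S.n) : S.TordS D lev (ν + 1) + S.tS D lev ≤ S.TordS D lev ν := by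
  unfold TordS tS remS
  have h := D.kstep_law lev ν hν
  have : S.n - ν = (S.n - (ν + 1)) + 1 := by omega
  rw [this]
  omega

/-- **Order condition of the half-step**: `TordS (lev+1) 0 + tS lev ≤ TordS lev n` for `lev + 1 ≤ Sd`. [cite: Nesterenko2003, (4.5)] -/
theorem TordS_half (lev : ℕ) (hlev : lev + 1 ≤ D.Sd) : S.TordS D (lev + 1) 0 + S.tS D lev ≤ S.TordS D lev S.n := by
  unfold TordS tS remS
  have h := D.half_law lev hlev
  have h3 : (D.Sd - lev) * (S.n + 1) = (D.Sd - (lev + 1)) * (S.n + 1) + (S.n + 1) := by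
    have : D.Sd - lev = (D.Sd - (lev + 1)) + 1 := by omega
    rw [this]; ring
  rw [h3]
  simp only [Nat.sub_self, Nat.sub_zero, add_zero]
  omega

/-- `#unk L₀ 𝔏 ≤ (L₀+1)·∏(2 sideⱼ + 1)` for `𝔏 ⊆ box side`. [folklore] -/
def UcardS : ℕ := (D.L₀ + 1) * ∏ j, (2 * S.sideS D j + 1)

/-- The bound. [folklore] -/
theorem card_unk_le_UcardS {𝔏 : Finset (Fin S.n → ℤ)} (h𝔏 : 𝔏 ⊆ S.box (S.sideS D)) : (S.unk D.L₀ 𝔏).card ≤ S.UcardS D := by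
  unfold UcardS
  rw [S.card_unk, ← S.card_box]
  exact Nat.mul_le_mul_left _ (card_le_card h𝔏)

/-- `TordS Sd n = Mord Sd n`. [folklore] -/
theorem TordS_last : S.TordS D D.Sd S.n = D.Mord D.Sd S.n := by
  unfold TordS remS; simp

end G3Setup

end Summit.ABC.StewartYu

end
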